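import Summits.BirchSwinnertonDyer.BirchSwinnertonDyer.Theorems.KolyvaginDepthDoorKolyvaginDepthSupplyDoorOfSystem
import HarnessLib

/-!
# Route `KolyvaginDepthDoor`, crux `KolyvaginDepthSupply` (stmt-BirchSwinnertonDyer-21765) —
# Kolyvagin's minimal-depth descent data for an ARBITRARY CLASS FAMILY `cl : ℕ → H¹(K, E[p^1])`

Helper file (`--supports stmt-BirchSwinnertonDyer-21765 --as helper`); it closes nothing and BSD is
not proved by it.

g5's `exists_hypothesesDepth_of_system` (file `…KolyvaginDepthSupplyDoorOfSystem`) builds the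
`KolyvaginDescent.HypothesesDepth` of Kolyvagin's minimal-depth descent on `H¹(K, E[p^1])` from a SYSTEM
`d : ∀ n : ℕ, KolyvaginHeegnerData Dt β ι n` — but the system enters the statement only through its
classes `(d n).kolyvaginClass hp 1`, and a system indexed by ALL `n : ℕ` is not known to exist (no
datum is known at `n = 0` or at levels meeting `N`). This file records the same theorem for an arbitrary
class family `cl`, so that the compatible system on the GOOD levels constructed in
`…KolyvaginHeegnerSystem` (PART 3) can be fed in (sequel `…KolyvaginDepthSupplyDoorOfDatum`):

* `exists_hypothesesDepth_of_classes` — hypotheses `hτc` (sign law, Gross Prop. 5.4 (2)), `hfin`/`hinf`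
  (McCallum Lemma 4.3), `h44` (Prop. 4.4 "in particular"), `hcyc` (Gross Prop. 8.1 (1)), `hdual`
  (reciprocity at finitely many Kolyvagin places) on the family `cl`; Čebotarev is the tree's theorem
  `McCallum1991.cor32_eigenclasses_infinite_primes_localOrder_holds`. Proof verbatim from g5.

References: [GrossLMS1991] §10 with Props. 5.4, 6.2, 8.1, 8.2; [McCallumLMS1991] Cor. 3.2, Lemma 4.3,
Prop. 4.4, Lemma 5.3; [Kolyvagin1991MathAnn] Thm. 2.3; [WZhang2014] Notations (xii).
-/

set_option linter.dupNamespace false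

noncomputable section

open scoped Classical

namespace Summit.BirchSwinnertonDyer.BirchSwinnertonDyer.Theorems.KolyvaginDepthDoor

open Literature.NumberTheory.EllipticCurves Literature.NumberTheory.EllipticCurves.ModularForms
  Literature.NumberTheory.EllipticCurves.KolyvaginDescent WeierstrassCurve NumberField IsDedekindDomain

section Classes

variable {W : WeierstrassCurve ℚ} [W.IsElliptic] [W.IsGloballyMinimal] [NeZero (W.conductorNorm ℤ)]
  {K : Type} [Field K] [NumberField K]

/-- **Kolyvagin's minimal-depth descent data for a class family `cl : ℕ → H¹(K, E[p^1])`** — g5's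
`exists_hypothesesDepth_of_system` with the system `d` replaced by its only trace in the statement, the
classes `cl n` (there `(d n).kolyvaginClass hp 1`): `E/ℚ` globally minimal without CM, `K` imaginary
quadratic with complex conjugation `c`, `p` odd with `ρ̄_{E,p^n}` onto for all `n`; hypotheses `hτc`,
`hfin`, `hinf`, `h44`, `hcyc`, `hdual` as there; Čebotarev = the tree's theorem
`McCallum1991.cor32_eigenclasses_infinite_primes_localOrder_holds` (`M = 1`). Proof verbatim.
[cite: GrossLMS1991, §10 (setting) with Props. 5.4, 6.2, 8.1, 8.2]
[cite: McCallumLMS1991, Cor. 3.2, Lemma 4.3, Prop. 4.4] -/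
theorem exists_hypothesesDepth_of_classes (hcm : ¬ W.HasCM) (hK : IsImaginaryQuadratic K)
    (p : ℕ) [hp : Fact p.Prime] (hp2 : p ≠ 2)
    (htower : ∀ n : ℕ, W.HasSurjectiveModNGaloisRep (p ^ n : ℕ))
    (c : K ≃ₐ[ℚ] K) (hc : c ≠ 1) (hcc : c * c = 1)
    (cl : ℕ → galH1Torsion (W.baseChange K) ((p ^ 1 : ℕ) : ℤ)) (ε : ℤ) (hε : ε = 1 ∨ ε = -1)
    (hτc : ∀ n : ℕ, Squarefree n →
      (∀ q ∈ n.primeFactors, Zhang2014.IsKolyvaginPrime (W.conductorNorm ℤ) W K p q) →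
      conjAct W c ((p ^ 1 : ℕ) : ℤ) (cl n) =
        (ε * (-1) ^ n.primeFactors.card) • cl n)
    (hfin : ∀ n : ℕ, Squarefree n →
      (∀ q ∈ n.primeFactors, Zhang2014.IsKolyvaginPrime (W.conductorNorm ℤ) W K p q) →
      ∀ v : HeightOneSpectrum (𝓞 K), (n : 𝓞 K) ∉ v.asIdeal →
        cl n ∈
          selmerLocalKer (W.baseChange K) (v.adicCompletion K) ((p ^ 1 : ℕ) : ℤ))
    (hinf : ∀ n : ℕ, Squarefree n →
      (∀ q ∈ n.primeFactors, Zhang2014.IsKolyvaginPrime (W.conductorNorm ℤ) W K p q) →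
      ∀ w : InfinitePlace K,
        cl n ∈ selmerLocalKer (W.baseChange K) w.Completion ((p ^ 1 : ℕ) : ℤ))
    (h44 : ∀ (ℓ m : ℕ), Squarefree (ℓ * m) →
      (∀ q ∈ (ℓ * m).primeFactors, Zhang2014.IsKolyvaginPrime (W.conductorNorm ℤ) W K p q) →
      Zhang2014.IsKolyvaginPrime (W.conductorNorm ℤ) W K p ℓ →
      ∀ v : HeightOneSpectrum (𝓞 K), (ℓ : 𝓞 K) ∈ v.asIdeal →
        (cl (ℓ * m) ∈
            selmerLocalKer (W.baseChange K) (v.adicCompletion K) ((p ^ 1 : ℕ) : ℤ) ↔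
          cl m ∈
            (W.baseChange K).torsionLocalKer (v.adicCompletion K) ((p ^ 1 : ℕ) : ℤ)))
    (hcyc : ∀ ℓ : ℕ, Zhang2014.IsKolyvaginPrime (W.conductorNorm ℤ) W K p ℓ →
      ∀ e : ℤ, (e = 1 ∨ e = -1) →
      ∀ s₁ ∈ selmerGroup (W.baseChange K) ((p ^ 1 : ℕ) : ℤ),
        conjAct W c ((p ^ 1 : ℕ) : ℤ) s₁ = e • s₁ →
      ∀ s₂ ∈ selmerGroup (W.baseChange K) ((p ^ 1 : ℕ) : ℤ),
        conjAct W c ((p ^ 1 : ℕ) : ℤ) s₂ = e • s₂ →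
      ∃ a b : ℤ, ¬ ((p : ℤ) ∣ a ∧ (p : ℤ) ∣ b) ∧
        ∀ v : HeightOneSpectrum (𝓞 K), (ℓ : 𝓞 K) ∈ v.asIdeal →
          a • s₁ + b • s₂ ∈ (W.baseChange K).torsionLocalKer (v.adicCompletion K) ((p ^ 1 : ℕ) : ℤ))
    (hdual : ∀ (T : Finset ℕ), (∀ q ∈ T, Zhang2014.IsKolyvaginPrime (W.conductorNorm ℤ) W K p q) →
      ∀ ℓ ∈ T, ∀ e : ℤ, (e = 1 ∨ e = -1) →
      ∀ x : galH1Torsion (W.baseChange K) ((p ^ 1 : ℕ) : ℤ),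
        conjAct W c ((p ^ 1 : ℕ) : ℤ) x = e • x →
        (∀ v : HeightOneSpectrum (𝓞 K), (∀ q ∈ T, (q : 𝓞 K) ∉ v.asIdeal) →
          x ∈ selmerLocalKer (W.baseChange K) (v.adicCompletion K) ((p ^ 1 : ℕ) : ℤ)) →
        (∀ w : InfinitePlace K, x ∈ selmerLocalKer (W.baseChange K) w.Completion ((p ^ 1 : ℕ) : ℤ)) →
      ∀ s ∈ selmerGroup (W.baseChange K) ((p ^ 1 : ℕ) : ℤ),
        conjAct W c ((p ^ 1 : ℕ) : ℤ) s = e • s →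
        (∀ q ∈ T, q ≠ ℓ → ∀ v : HeightOneSpectrum (𝓞 K), (q : 𝓞 K) ∈ v.asIdeal →
          s ∈ (W.baseChange K).torsionLocalKer (v.adicCompletion K) ((p ^ 1 : ℕ) : ℤ)) →
        ∀ v : HeightOneSpectrum (𝓞 K), (ℓ : 𝓞 K) ∈ v.asIdeal →
          s ∉ (W.baseChange K).torsionLocalKer (v.adicCompletion K) ((p ^ 1 : ℕ) : ℤ) →
          x ∈ selmerLocalKer (W.baseChange K) (v.adicCompletion K) ((p ^ 1 : ℕ) : ℤ)) :
    ∃ S : HypothesesDepth (galH1Torsion (W.baseChange K) ((p ^ 1 : ℕ) : ℤ))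
        (HeightOneSpectrum (𝓞 K) ⊕ InfinitePlace K),
      S.Sel = selmerGroup (W.baseChange K) ((p ^ 1 : ℕ) : ℤ) ∧ S.p = p ∧
        S.c = cl ∧
        S.Kol = Zhang2014.IsKolyvaginPrime (W.conductorNorm ℤ) W K p ∧
        S.τ = conjAct W c ((p ^ 1 : ℕ) : ℤ) := by
  have hpP : p.Prime := hp.out
  have h32 := McCallum1991.cor32_eigenclasses_infinite_primes_localOrder_holds (W.conductorNorm ℤ) W
    hcm K hK p hpP hp2 htower c hc 1 le_rfl
  -- the place of a Kolyvagin prime and the strict local condition there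
  let plZ : ∀ ℓ : ℕ, Zhang2014.IsKolyvaginPrime (W.conductorNorm ℤ) W K p ℓ →
      HeightOneSpectrum (𝓞 K) := fun ℓ h ↦
    ⟨Ideal.span {(ℓ : 𝓞 K)}, h.2.2.2.2.1, by
      rw [Ne, Ideal.span_singleton_eq_bot]; exact_mod_cast h.1.ne_zero⟩
  have hplZ : ∀ (ℓ : ℕ) (h : Zhang2014.IsKolyvaginPrime (W.conductorNorm ℤ) W K p ℓ)
      (v : HeightOneSpectrum (𝓞 K)), (ℓ : 𝓞 K) ∈ v.asIdeal ↔ v = plZ ℓ h :=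
    fun ℓ h v ↦ mem_asIdeal_iff_eq_of_zhangKolyvaginPrime h v
  have hmemZ : ∀ (ℓ : ℕ) (h : Zhang2014.IsKolyvaginPrime (W.conductorNorm ℤ) W K p ℓ),
      (ℓ : 𝓞 K) ∈ (plZ ℓ h).asIdeal := fun ℓ h ↦ (hplZ ℓ h _).mpr rfl
  have hcast : ((p ^ 1 : ℕ) : ℤ) = (p : ℤ) := by rw [pow_one]
  have htors : ∀ v : galH1Torsion (W.baseChange K) ((p ^ 1 : ℕ) : ℤ), (p : ℤ) • v = 0 := by
    intro v
    have h := zsmul_discreteH1_torsion ((p ^ 1 : ℕ) : ℤ) v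
    have e : ((p ^ 1 : ℕ) : ℤ) • v = (p : ℤ) • v := congrArg (fun z : ℤ ↦ z • v) hcast
    rw [← e]
    exact h
  exact ⟨
    { p := p
      hp := hpP
      hp2 := hp2
      torsion := htors
      τ := conjAct W c ((p ^ 1 : ℕ) : ℤ)
      τ_τ := conjAct_conjAct_of_mul_self W hcc _
      Sel := selmerGroup (W.baseChange K) ((p ^ 1 : ℕ) : ℤ)
      τ_mem := fun s hs ↦ conjAct_mem_selmerGroup W hK.2.isComplex c _ hs
      Loc := Sum.elim
        (fun v ↦ selmerLocalKer (W.baseChange K) (v.adicCompletion K) ((p ^ 1 : ℕ) : ℤ))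
        (fun w ↦ selmerLocalKer (W.baseChange K) w.Completion ((p ^ 1 : ℕ) : ℤ))
      mem_sel_iff := fun s ↦ by rw [mem_selmerGroup_iff, Sum.forall]; rfl
      Kol := Zhang2014.IsKolyvaginPrime (W.conductorNorm ℤ) W K p
      prime_of_kol := fun ℓ h ↦ h.1
      pl := fun ℓ ↦ if h : Zhang2014.IsKolyvaginPrime (W.conductorNorm ℤ) W K p ℓ then
        Sum.inl (plZ ℓ h) else Sum.inr (Classical.arbitrary _)
      Dv := fun v n ↦ Sum.elim (fun v ↦ (n : 𝓞 K) ∈ v.asIdeal) (fun _ ↦ False) v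
      dv_iff := fun ℓ hℓ v ↦ by
        rw [dif_pos hℓ]
        rcases v with v | w
        · simp only [Sum.elim_inl, Sum.inl.injEq]
          exact hplZ ℓ hℓ v
        · simp
      dv_mul := fun a b v ↦ by
        rcases v with v | w
        · exact natCast_mul_mem_asIdeal
        · simp
      dv_one := fun v ↦ by
        rcases v with v | w
        · simp only [Sum.elim_inl, Nat.cast_one]
          exact v.asIdeal.ne_top_iff_one.mp v.isPrime.ne_top
        · simp
      A := fun ℓ ↦ ⨅ (v : HeightOneSpectrum (𝓞 K)) (_ : (ℓ : 𝓞 K) ∈ v.asIdeal),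
        (W.baseChange K).torsionLocalKer (v.adicCompletion K) ((p ^ 1 : ℕ) : ℤ)
      ε := ε
      hε := hε
      c := cl
      τ_c := fun n hn ↦ hτc n hn.1 hn.2
      c_mem_loc := fun n hn v hv ↦ by
        rcases v with v | w
        · exact hfin n hn.1 hn.2 v hv
        · exact hinf n hn.1 hn.2 w
      c_mem_loc_iff := fun ℓ m hℓ hn ↦ by
        rw [dif_pos hℓ]
        simp only [Sum.elim_inl, AddSubgroup.mem_iInf]
        rw [h44 ℓ m hn.1 hn.2 hℓ (plZ ℓ hℓ) (hmemZ ℓ hℓ)]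
        constructor
        · intro h v hv
          rwa [(hplZ ℓ hℓ v).mp hv]
        · intro h
          exact h (plZ ℓ hℓ) (hmemZ ℓ hℓ)
      duality := fun T hT ℓ hℓT e he x hx hoff s hs hτs hsT hsℓ ↦ by
        have hℓ : Zhang2014.IsKolyvaginPrime (W.conductorNorm ℤ) W K p ℓ := hT ℓ hℓT
        rw [dif_pos hℓ]
        simp only [Sum.elim_inl]
        have hsv : s ∉ (W.baseChange K).torsionLocalKer ((plZ ℓ hℓ).adicCompletion K)
            ((p ^ 1 : ℕ) : ℤ) := by
          intro h
          apply hsℓ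
          simp only [AddSubgroup.mem_iInf]
          intro v hv
          rwa [(hplZ ℓ hℓ v).mp hv]
        refine hdual T hT ℓ hℓT e he x hx (fun v hv ↦ ?_) (fun w ↦ ?_) s hs hτs
          (fun q hq hne v hv ↦ ?_) (plZ ℓ hℓ) (hmemZ ℓ hℓ) hsv
        · exact hoff (Sum.inl v) fun q hq heq ↦ by
            have hq' : Zhang2014.IsKolyvaginPrime (W.conductorNorm ℤ) W K p q := hT q hq
            rw [dif_pos hq'] at heq
            exact hv q hq ((hplZ q hq' v).mpr (Sum.inl_injective heq))
        · exact hoff (Sum.inr w) fun q hq heq ↦ by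
            have hq' : Zhang2014.IsKolyvaginPrime (W.conductorNorm ℤ) W K p q := hT q hq
            rw [dif_pos hq'] at heq
            exact Sum.inr_ne_inl heq
        · have hsA := hsT q hq hne
          simp only [AddSubgroup.mem_iInf] at hsA
          exact hsA v hv
      local_cyclic := fun ℓ hℓ e he s₁ hs₁ hτ₁ s₂ hs₂ hτ₂ ↦ by
        obtain ⟨a, b, hab, hmem⟩ := hcyc ℓ hℓ e he s₁ hs₁ hτ₁ s₂ hs₂ hτ₂
        refine ⟨a, b, hab, ?_⟩
        simp only [AddSubgroup.mem_iInf]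
        exact hmem
      cebotarev := fun r cs Nv hN hτ hind b ↦ by
        -- independence mod `p` gives non-vanishing and McCallum's order form
        have hne : ∀ i, cs i ≠ 0 := by
          intro i hi
          have h := hind (fun j ↦ if j = i then 1 else 0) (by
            rw [Finset.sum_eq_single i (fun j _ hj ↦ by rw [if_neg hj, zero_zsmul])
              (fun h ↦ absurd (Finset.mem_univ i) h), if_pos rfl, one_zsmul, hi]) i
          rw [if_pos rfl] at h
          have : (p : ℤ) ≤ 1 := Int.le_of_dvd one_pos h
          have : (2 : ℤ) ≤ p := by exact_mod_cast hpP.two_le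
          omega
        have hord : ∀ i, addOrderOf (cs i) = p ^ (fun _ : Fin r ↦ 1) i := by
          intro i
          show addOrderOf (cs i) = p ^ 1
          exact (addOrderOf_eq_prime (by rw [← natCast_zsmul]; exact htors (cs i)) (hne i)).trans
            (pow_one p).symm
        have hind' : ∀ a : Fin r → ℤ, ∑ i, a i • cs i = 0 → ∀ i, (addOrderOf (cs i) : ℤ) ∣ a i := by
          intro a ha i
          rw [hord i, pow_one]
          exact hind a ha i
        obtain ⟨ℓ, ⟨-, hℓ, -, hloc⟩, hlt⟩ :=
          (h32 r cs hne hτ hind' (fun _ ↦ 1) hord Nv hN).exists_gt b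
        refine ⟨ℓ, hlt, hℓ, fun i ↦ ?_⟩
        simp only [AddSubgroup.mem_iInf]
        have key : ∀ v : HeightOneSpectrum (𝓞 K), (ℓ : 𝓞 K) ∈ v.asIdeal →
            (cs i ∈ (W.baseChange K).torsionLocalKer (v.adicCompletion K) ((p ^ 1 : ℕ) : ℤ) ↔
              Nv i = 0) := by
          intro v hv
          have h0 := hloc i v hv 0
          rw [pow_zero, Nat.cast_one, one_zsmul, Nat.le_zero] at h0
          exact h0
        constructor
        · intro h
          exact (key (plZ ℓ hℓ) (hmemZ ℓ hℓ)).mp (h (plZ ℓ hℓ) (hmemZ ℓ hℓ))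
        · intro h v hv
          exact (key v hv).mpr h }, rfl, rfl, rfl, rfl, rfl⟩

end Classes

end Summit.BirchSwinnertonDyer.BirchSwinnertonDyer.Theorems.KolyvaginDepthDoor

end
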